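import Summits.KontsevichZagierPeriods.KontsevichZagierPeriods.Theorems.TerasomaMultiplicationMultiplicationAccessibleTranslateSTwo

/-!
# `MultiplicationAccessible` (stmt-KontsevichZagierPeriods-12305), line `shifted-family-prime-sieve`:
the `s`-TRANSLATION of the shifted family in GENERAL dimension — `GM(m; x, s+1) → GM(m; x, s)`

The shifted Gauss-multiplication family `GM(m; x, s)` (`n = m + 1`: every box representation of
`∏_(k<n) B(x + k/n, s)` — integrand `∏ₖ zₖ^(x+k/n−1)(1−zₖ)^(s−1)` on `(0,1)ⁿ` — is equivalent,
under the moves of Kontsevich–Zagier 2001 §1.2, to every box representation of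
`n^(ns) B(nx, ns) ∏_(j=1)^m B(js, s)`, pinned exactly as in
`Theorems/TerasomaMultiplicationMultiplicationAccessibleSieve.lean`) at the parameter `s + 1`
implies it at `s` (`gm_of_gm_succ_s`, registered sub-goal of the line; its case `m = 2` is
`gmTwo_of_gmTwo_succ_s`, `Theorems/TerasomaMultiplicationMultiplicationAccessibleTranslateSTwo.lean`).
Together with the `x`-translation `gm_of_gm_succ_x`
(`Theorems/TerasomaMultiplicationMultiplicationAccessibleTranslateX.lean`) this reduces the family
for all rational `x, s > 0` to the family for large `x, s` (the range of the corner Stokes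
argument).

Everything is book-keeping in the formal period ring `P = KZ.FormalPeriodRing` with the Beta classes
`g(p,q) = ⟦β(p,q)⟧` of a pinned Beta family (`MultGlue.exists_betaFamily`) and the rational point
constants `⟦[pt, q]⟧`, `q ∈ ℚ` (`TranslateX.ptQ_mul`, `TranslateX.ptQ_prod`; a nonzero one cancels,
`TranslateX.ptQ_cancel`):
* the translation `⟦a+b⟧ g(a, b+1) = ⟦b⟧ g(a,b)` (`TranslateX.transl_snd_eq`, ONE Newton–Leibniz
  move, `KZ.betaTranslation_equivalent`) and, iterated in the first argument,
  `⟦∏_(i<j)(a+b+i)⟧ g(a+j, b) = ⟦∏_(i<j)(a+i)⟧ g(a,b)` (`TranslateX.transl_fst_iter_eq`); two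
  reflections (`Doubling.refl_eq`) give the iterate in the second argument (`snd_iter_eq`);
* the pinned `GM(m; x, s)` is the identity
  `⟦1⟧ ∏ₖ g(x+k/n, s) = ⟦n^(ns)⟧ g(nx,ns) ∏_(j<m) g((j+1)s, s)` in `P` (`TranslateX.prod_eq_of_pinned`)
  and conversely (`TranslateS.pinned_of_prod_eq`);
* from `s+1` to `s` (`TranslateSGen.gm_prod_eq_step`): on the left every factor is translated once
  in the second argument (`snd_prod_eq`: constants `∏ₖ (x+k/n+s)` against `sⁿ`); on the right
  `g(nx, n(s+1)) = g(nx, ns+n)` is translated `n` times in the second argument (`snd_iter_eq`: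
  `∏_(i<n)(nx+ns+i)` against `∏_(i<n)(ns+i)`), every Dirichlet factor `g((j+1)(s+1), s+1)` once
  in the second and `j+1` times in the first argument (`dirichlet_step`: `∏_(i≤j+1)((j+2)s+i)`
  against `s·∏_(i≤j)((j+1)s+i)`), the Gauss constant is `n^(n(s+1)) = nⁿ · n^(ns)`
  (`gaussConst_succ`, `Real.rpow_add`); the rational constants so produced agree (`const_eq`:
  `∏(nx+ns+i) = nⁿ∏(x+k/n+s)` termwise, `range_prod_eq`, and the telescoping
  `s^(m+1) ∏_(j<m) F(j+2) = F(m+1) ∏_(j<m) s F(j+1)`, `F(J) = ∏_(i<J)(Js+i)`, `F(1) = s`,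
  `tele_eq`), and a nonzero rational point constant cancels.
References: Kontsevich–Zagier 2001 §1.2, §4.1; Andrews–Askey–Roy 1999, §1.1
(`B(u, v+1) = B(u,v)·v/(u+v)`), Thm 1.5.2 (Gauss multiplication).
-/

noncomputable section

open MeasureTheory Set Finset
open scoped BigOperators
open Literature.NumberTheory.Transcendental
open Literature.NumberTheory.Transcendental.KZ

namespace Summit.KontsevichZagierPeriods.TerasomaMultiplication.MultiplicationAccessible

namespace TranslateSGen

open TranslateX

/-! ## Translations of Beta classes in `P` -/

/-- **Iterated translation in the second argument**:
`⟦[pt, ∏_(i<j) (a+b+i)]⟧ g(a, b+j) = ⟦[pt, ∏_(i<j) (b+i)]⟧ g(a, b)` —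
`TranslateX.transl_fst_iter_eq` between two reflections `g(p,q) = g(q,p)` (`Doubling.refl_eq`).
[cite: AndrewsAskeyRoy1999, §1.1] -/
theorem snd_iter_eq {B : ℚ → ℚ → IntegralRep 1}
    (hB : ∀ p q, 0 < p → 0 < q → (B p q).domain = {t | t 0 ∈ Set.Ioo (0:ℝ) 1} ∧
      (B p q).integrand = fun t => (t 0) ^ ((p:ℝ) - 1) * (1 - t 0) ^ ((q:ℝ) - 1))
    {a b : ℚ} (ha : 0 < a) (hb : 0 < b) (j : ℕ) :
    toFormalPeriod (of (IntegralRep.unit.constMul _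
        (isAlgebraic_ratCast (∏ i ∈ range j, (a + b + i))))) * toFormalPeriod (of (B a (b + j))) =
      toFormalPeriod (of (IntegralRep.unit.constMul _
        (isAlgebraic_ratCast (∏ i ∈ range j, (b + i))))) * toFormalPeriod (of (B a b)) := by
  have h := transl_fst_iter_eq hB hb ha j
  have hbj : (0:ℚ) < b + j := by positivity
  rw [Doubling.refl_eq hB hbj ha, Doubling.refl_eq hB hb ha,
    show ∏ i ∈ range j, (b + a + (i:ℚ)) = ∏ i ∈ range j, (a + b + (i:ℚ)) from
      prod_congr rfl fun i _ => by ring] at h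
  exact h

/-- **The left-hand side translated once in the second argument of every factor** (`n = m + 1`):
`⟦[pt, ∏_k (x + k/n + s)]⟧ ∏_k g(x + k/n, s+1) = ⟦[pt, ∏_k s]⟧ ∏_k g(x + k/n, s)`
(`TranslateX.transl_snd_eq` termwise). [cite: AndrewsAskeyRoy1999, §1.1] -/
theorem snd_prod_eq {B : ℚ → ℚ → IntegralRep 1}
    (hB : ∀ p q, 0 < p → 0 < q → (B p q).domain = {t | t 0 ∈ Set.Ioo (0:ℝ) 1} ∧
      (B p q).integrand = fun t => (t 0) ^ ((p:ℝ) - 1) * (1 - t 0) ^ ((q:ℝ) - 1))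
    (m : ℕ) {x s : ℚ} (hx : 0 < x) (hs : 0 < s) :
    toFormalPeriod (of (IntegralRep.unit.constMul _
        (isAlgebraic_ratCast (∏ k : Fin (m + 1), (x + (k : ℚ) / ((m : ℚ) + 1) + s))))) *
        ∏ k : Fin (m + 1), toFormalPeriod (of (B (x + (k : ℚ) / ((m : ℚ) + 1)) (s + 1))) =
      toFormalPeriod (of (IntegralRep.unit.constMul _
        (isAlgebraic_ratCast (∏ _k : Fin (m + 1), s)))) *
        ∏ k : Fin (m + 1), toFormalPeriod (of (B (x + (k : ℚ) / ((m : ℚ) + 1)) s)) := by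
  rw [ptQ_prod, ptQ_prod, ← prod_mul_distrib, ← prod_mul_distrib]
  exact prod_congr rfl fun k _ => transl_snd_eq hB (by positivity) hs

/-- **One Dirichlet factor from `s + 1` to `s`**: `g((j+1)(s+1), s+1) → g((j+1)(s+1), s)` (one
translation in the second argument) `→ g((j+1)s, s)` (`j + 1` translations in the first argument,
`(j+1)(s+1) = (j+1)s + (j+1)`); the constants collect to
`⟦[pt, ∏_(i<j+2) ((j+2)s + i)]⟧ g((j+1)(s+1), s+1) = ⟦[pt, s · ∏_(i<j+1) ((j+1)s + i)]⟧ g((j+1)s, s)`.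
[cite: AndrewsAskeyRoy1999, §1.1] -/
theorem dirichlet_step {B : ℚ → ℚ → IntegralRep 1}
    (hB : ∀ p q, 0 < p → 0 < q → (B p q).domain = {t | t 0 ∈ Set.Ioo (0:ℝ) 1} ∧
      (B p q).integrand = fun t => (t 0) ^ ((p:ℝ) - 1) * (1 - t 0) ^ ((q:ℝ) - 1))
    {s : ℚ} (hs : 0 < s) (j : ℕ) :
    toFormalPeriod (of (IntegralRep.unit.constMul _
        (isAlgebraic_ratCast (∏ i ∈ range (j + 1 + 1), (((j:ℚ) + 1 + 1) * s + i))))) *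
        toFormalPeriod (of (B (((j:ℚ) + 1) * (s + 1)) (s + 1))) =
      toFormalPeriod (of (IntegralRep.unit.constMul _
        (isAlgebraic_ratCast (s * ∏ i ∈ range (j + 1), (((j:ℚ) + 1) * s + i))))) *
        toFormalPeriod (of (B (((j:ℚ) + 1) * s) s)) := by
  have t1 := transl_snd_eq hB (a := ((j:ℚ) + 1) * (s + 1)) (b := s) (by positivity) hs
  have t2 := transl_fst_iter_eq hB (a := ((j:ℚ) + 1) * s) (b := s) (by positivity) hs (j + 1)
  rw [show ((j:ℚ) + 1) * s + ((j + 1 : ℕ) : ℚ) = ((j:ℚ) + 1) * (s + 1) by push_cast; ring]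
    at t2
  have hc : ∏ i ∈ range (j + 1 + 1), (((j:ℚ) + 1 + 1) * s + i) =
      (∏ i ∈ range (j + 1), (((j:ℚ) + 1) * s + s + i)) * (((j:ℚ) + 1) * (s + 1) + s) := by
    rw [prod_range_succ]
    congr 1
    · exact prod_congr rfl fun i _ => by ring
    · push_cast; ring
  rw [hc, ptQ_mul, ptQ_mul]
  linear_combination
    toFormalPeriod (of (IntegralRep.unit.constMul _
        (isAlgebraic_ratCast (∏ i ∈ range (j + 1), (((j:ℚ) + 1) * s + s + i))))) * t1
    + toFormalPeriod (of (IntegralRep.unit.constMul _ (isAlgebraic_ratCast s))) * t2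

/-- **All Dirichlet factors from `s + 1` to `s`** (`dirichlet_step` termwise over `j < m`).
[cite: AndrewsAskeyRoy1999, §1.1] -/
theorem dirichlet_prod_eq {B : ℚ → ℚ → IntegralRep 1}
    (hB : ∀ p q, 0 < p → 0 < q → (B p q).domain = {t | t 0 ∈ Set.Ioo (0:ℝ) 1} ∧
      (B p q).integrand = fun t => (t 0) ^ ((p:ℝ) - 1) * (1 - t 0) ^ ((q:ℝ) - 1))
    (m : ℕ) {s : ℚ} (hs : 0 < s) :
    toFormalPeriod (of (IntegralRep.unit.constMul _ (isAlgebraic_ratCast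
        (∏ j : Fin m, ∏ i ∈ range ((j:ℕ) + 1 + 1), ((((j:ℕ):ℚ) + 1 + 1) * s + i))))) *
        ∏ j : Fin m, toFormalPeriod (of (B ((((j:ℕ):ℚ) + 1) * (s + 1)) (s + 1))) =
      toFormalPeriod (of (IntegralRep.unit.constMul _ (isAlgebraic_ratCast
        (∏ j : Fin m, (s * ∏ i ∈ range ((j:ℕ) + 1), ((((j:ℕ):ℚ) + 1) * s + i)))))) *
        ∏ j : Fin m, toFormalPeriod (of (B ((((j:ℕ):ℚ) + 1) * s) s)) := by
  rw [ptQ_prod, ptQ_prod, ← prod_mul_distrib, ← prod_mul_distrib]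
  exact prod_congr rfl fun j _ => dirichlet_step hB hs j

/-! ## The constants -/

/-- The Gauss constants: `n^(n(s+1)) = nⁿ · n^(ns)`, `n = m + 1` (`Real.rpow_add`,
`Real.rpow_natCast`). [folklore] -/
theorem gaussConst_succ (m : ℕ) (s : ℚ) :
    ((m:ℝ) + 1) ^ (((m:ℝ) + 1) * (((s + 1 : ℚ)) : ℝ)) =
      ((((m : ℚ) + 1) ^ (m + 1) : ℚ) : ℝ) * ((m:ℝ) + 1) ^ (((m:ℝ) + 1) * (s:ℝ)) := by
  have h : (0:ℝ) < (m:ℝ) + 1 := by positivity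
  rw [show ((m:ℝ) + 1) * (((s + 1 : ℚ)) : ℝ) = ((m:ℝ) + 1) * (s:ℝ) + ((m + 1 : ℕ) : ℝ) by
      push_cast; ring,
    Real.rpow_add h, Real.rpow_natCast]
  push_cast
  ring

/-- `∏_(i<n) (nx + ns + i) = nⁿ ∏_k (x + k/n + s)`, `n = m + 1` (termwise
`nx + ns + i = n(x + i/n + s)`). [folklore] -/
theorem range_prod_eq (m : ℕ) (x s : ℚ) :
    ∏ i ∈ range (m + 1), (((m : ℚ) + 1) * x + ((m : ℚ) + 1) * s + i) =
      ((m : ℚ) + 1) ^ (m + 1) * ∏ k : Fin (m + 1), (x + (k : ℚ) / ((m : ℚ) + 1) + s) := by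
  rw [← Fin.prod_univ_eq_prod_range (fun i => ((m : ℚ) + 1) * x + ((m : ℚ) + 1) * s + i)
      (m + 1), ← Fin.prod_const, ← prod_mul_distrib]
  refine prod_congr rfl fun k _ => ?_
  have hn : ((m : ℚ) + 1) ≠ 0 := by positivity
  field_simp
  ring

/-- **The telescoping**: with `F(J) = ∏_(i<J) (Js + i)` (so `F(1) = s`),
`s^(m+1) · ∏_(j<m) F(j+2) = F(m+1) · ∏_(j<m) (s · F(j+1))`, since both
`s · ∏_(j<m) F(j+2)` and `(∏_(j<m) F(j+1)) · F(m+1)` are `∏_(j≤m) F(j+1)`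
(`Fin.prod_univ_succ`, `Fin.prod_univ_castSucc`). [folklore] -/
theorem tele_eq (m : ℕ) (s : ℚ) :
    (∏ _k : Fin (m + 1), s) *
        ∏ j : Fin m, ∏ i ∈ range ((j:ℕ) + 1 + 1), ((((j:ℕ):ℚ) + 1 + 1) * s + i) =
      (∏ i ∈ range (m + 1), (((m : ℚ) + 1) * s + i)) *
        ∏ j : Fin m, (s * ∏ i ∈ range ((j:ℕ) + 1), ((((j:ℕ):ℚ) + 1) * s + i)) := by
  have h1 := Fin.prod_univ_castSucc
    (fun j : Fin (m + 1) => ∏ i ∈ range ((j:ℕ) + 1), ((((j:ℕ):ℚ) + 1) * s + i))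
  have h2 := Fin.prod_univ_succ
    (fun j : Fin (m + 1) => ∏ i ∈ range ((j:ℕ) + 1), ((((j:ℕ):ℚ) + 1) * s + i))
  simp only [Fin.val_castSucc, Fin.val_last, Fin.val_zero, Fin.val_succ, Nat.cast_zero, zero_add,
    range_one, Finset.prod_singleton, add_zero, one_mul, Nat.cast_add, Nat.cast_one] at h1 h2
  rw [prod_mul_distrib, Fin.prod_const, Fin.prod_const]
  linear_combination (-(s ^ m)) * (h1.symm.trans h2)

/-- **The constants agree**:
`sⁿ · ∏_(i<n)(nx+ns+i) · ∏_(j<m) F(j+2) = ∏_k (x+k/n+s) · nⁿ · F(n) · ∏_(j<m) s F(j+1)` in `ℚ`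
(`range_prod_eq`, `tele_eq`). [folklore] -/
theorem const_eq (m : ℕ) (x s : ℚ) :
    (∏ _k : Fin (m + 1), s) *
          (∏ i ∈ range (m + 1), (((m : ℚ) + 1) * x + ((m : ℚ) + 1) * s + i)) *
        ∏ j : Fin m, ∏ i ∈ range ((j:ℕ) + 1 + 1), ((((j:ℕ):ℚ) + 1 + 1) * s + i) =
      (∏ k : Fin (m + 1), (x + (k : ℚ) / ((m : ℚ) + 1) + s)) * ((m : ℚ) + 1) ^ (m + 1) *
          (∏ i ∈ range (m + 1), (((m : ℚ) + 1) * s + i)) *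
        ∏ j : Fin m, (s * ∏ i ∈ range ((j:ℕ) + 1), ((((j:ℕ):ℚ) + 1) * s + i)) := by
  rw [range_prod_eq]
  linear_combination
    (((m : ℚ) + 1) ^ (m + 1) * ∏ k : Fin (m + 1), (x + (k : ℚ) / ((m : ℚ) + 1) + s)) * tele_eq m s

/-! ## From `s + 1` to `s` in `P` -/

/-- **`GM(m)` in `P` at `s + 1` gives `GM(m)` in `P` at `s`**: `n` second-argument translations on
the left (`snd_prod_eq`), `n` on the right-hand factor `g(nx, n(s+1))` (`snd_iter_eq`), `1 + (j+1)`
translations on the `j`-th Dirichlet factor (`dirichlet_prod_eq`), the constant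
`n^(n(s+1)) = ⟦nⁿ⟧ n^(ns)` (`gaussConst_succ`), the rational identity `const_eq`, and the
cancellation of a nonzero rational point constant (`TranslateX.ptQ_cancel`).
[cite: AndrewsAskeyRoy1999, Thm 1.5.2] -/
theorem gm_prod_eq_step {B : ℚ → ℚ → IntegralRep 1}
    (hB : ∀ p q, 0 < p → 0 < q → (B p q).domain = {t | t 0 ∈ Set.Ioo (0:ℝ) 1} ∧
      (B p q).integrand = fun t => (t 0) ^ ((p:ℝ) - 1) * (1 - t 0) ^ ((q:ℝ) - 1))
    (m : ℕ) {x s : ℚ} (hx : 0 < x) (hs : 0 < s)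
    (h1 : toFormalPeriod (of (IntegralRep.unit.constMul (1:ℝ) isAlgebraic_one)) *
        ∏ k : Fin (m + 1), toFormalPeriod (of (B (x + (k : ℚ) / ((m : ℚ) + 1)) (s + 1))) =
      toFormalPeriod (of (IntegralRep.unit.constMul
        (((m:ℝ) + 1) ^ (((m:ℝ) + 1) * (((s + 1 : ℚ)) : ℝ)))
        (MultGlue.isAlgebraic_gaussConst m (s + 1)))) *
        ∏ k : Fin (m + 1), toFormalPeriod (of (B
          (if (k : ℕ) = 0 then ((m : ℚ) + 1) * x else (k : ℚ) * (s + 1))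
          (if (k : ℕ) = 0 then ((m : ℚ) + 1) * (s + 1) else (s + 1))))) :
    toFormalPeriod (of (IntegralRep.unit.constMul (1:ℝ) isAlgebraic_one)) *
        ∏ k : Fin (m + 1), toFormalPeriod (of (B (x + (k : ℚ) / ((m : ℚ) + 1)) s)) =
      toFormalPeriod (of (IntegralRep.unit.constMul (((m:ℝ) + 1) ^ (((m:ℝ) + 1) * (s:ℝ)))
        (MultGlue.isAlgebraic_gaussConst m s))) *
        ∏ k : Fin (m + 1), toFormalPeriod (of (B
          (if (k : ℕ) = 0 then ((m : ℚ) + 1) * x else (k : ℚ) * s)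
          (if (k : ℕ) = 0 then ((m : ℚ) + 1) * s else s))) := by
  rw [MultGlue.ptConst_one, one_mul, rhs_split] at h1 ⊢
  -- (A) the left-hand side, (B) the factor `g(nx, n(s+1))`, (C) the Dirichlet factors
  have hA := snd_prod_eq hB m hx hs
  have hBB := snd_iter_eq hB (a := ((m : ℚ) + 1) * x) (b := ((m : ℚ) + 1) * s)
    (by positivity) (by positivity) (m + 1)
  rw [show ((m : ℚ) + 1) * s + ((m + 1 : ℕ) : ℚ) = ((m : ℚ) + 1) * (s + 1) by push_cast; ring]
    at hBB
  have hCC := dirichlet_prod_eq hB m hs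
  -- (D) the Gauss constant `n^(n(s+1)) = ⟦nⁿ⟧ n^(ns)`
  have hC : toFormalPeriod (of (IntegralRep.unit.constMul
        (((m:ℝ) + 1) ^ (((m:ℝ) + 1) * (((s + 1 : ℚ)) : ℝ)))
        (MultGlue.isAlgebraic_gaussConst m (s + 1)))) =
      toFormalPeriod (of (IntegralRep.unit.constMul _
        (isAlgebraic_ratCast (((m : ℚ) + 1) ^ (m + 1))))) *
        toFormalPeriod (of (IntegralRep.unit.constMul (((m:ℝ) + 1) ^ (((m:ℝ) + 1) * (s:ℝ)))
          (MultGlue.isAlgebraic_gaussConst m s))) := by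
    rw [← MultGlue.ptConst_mul (isAlgebraic_ratCast (((m : ℚ) + 1) ^ (m + 1)))
      (MultGlue.isAlgebraic_gaussConst m s)
      ((isAlgebraic_ratCast (((m : ℚ) + 1) ^ (m + 1))).mul (MultGlue.isAlgebraic_gaussConst m s))]
    exact MultGlue.ptConst_congr _ _ (gaussConst_succ m s)
  -- (E) the rational constants agree (`const_eq`, transported to `P`)
  have hQ := congrArg (fun q : ℚ => toFormalPeriod (of (IntegralRep.unit.constMul _
    (isAlgebraic_ratCast q)))) (const_eq m x s)
  simp only [ptQ_mul] at hQ
  -- cancel the nonzero rational constant `sⁿ · ∏_i (nx + ns + i) · ∏_j F(j+2)`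
  have hne : (∏ _k : Fin (m + 1), s) *
        (∏ i ∈ range (m + 1), (((m : ℚ) + 1) * x + ((m : ℚ) + 1) * s + i)) *
      ∏ j : Fin m, ∏ i ∈ range ((j:ℕ) + 1 + 1), ((((j:ℕ):ℚ) + 1 + 1) * s + i) ≠ 0 :=
    (mul_pos (mul_pos (prod_pos fun _ _ => hs) (prod_pos fun i _ => by positivity))
      (prod_pos fun j _ => prod_pos fun i _ => by positivity)).ne'
  refine ptQ_cancel hne ?_
  rw [ptQ_mul, ptQ_mul]
  linear_combination
    (-(toFormalPeriod (of (IntegralRep.unit.constMul _ (isAlgebraic_ratCast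
          (∏ i ∈ range (m + 1), (((m : ℚ) + 1) * x + ((m : ℚ) + 1) * s + i))))) *
        toFormalPeriod (of (IntegralRep.unit.constMul _ (isAlgebraic_ratCast
          (∏ j : Fin m, ∏ i ∈ range ((j:ℕ) + 1 + 1), ((((j:ℕ):ℚ) + 1 + 1) * s + i))))))) * hA
    + (toFormalPeriod (of (IntegralRep.unit.constMul _ (isAlgebraic_ratCast
          (∏ k : Fin (m + 1), (x + (k : ℚ) / ((m : ℚ) + 1) + s))))) *
        toFormalPeriod (of (IntegralRep.unit.constMul _ (isAlgebraic_ratCast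
          (∏ i ∈ range (m + 1), (((m : ℚ) + 1) * x + ((m : ℚ) + 1) * s + i))))) *
        toFormalPeriod (of (IntegralRep.unit.constMul _ (isAlgebraic_ratCast
          (∏ j : Fin m, ∏ i ∈ range ((j:ℕ) + 1 + 1), ((((j:ℕ):ℚ) + 1 + 1) * s + i)))))) * h1
    + (toFormalPeriod (of (IntegralRep.unit.constMul _ (isAlgebraic_ratCast
          (∏ k : Fin (m + 1), (x + (k : ℚ) / ((m : ℚ) + 1) + s))))) *
        toFormalPeriod (of (IntegralRep.unit.constMul _ (isAlgebraic_ratCast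
          (∏ i ∈ range (m + 1), (((m : ℚ) + 1) * x + ((m : ℚ) + 1) * s + i))))) *
        toFormalPeriod (of (IntegralRep.unit.constMul _ (isAlgebraic_ratCast
          (∏ j : Fin m, ∏ i ∈ range ((j:ℕ) + 1 + 1), ((((j:ℕ):ℚ) + 1 + 1) * s + i))))) *
        toFormalPeriod (of (B (((m:ℚ) + 1) * x) (((m:ℚ) + 1) * (s + 1)))) *
        ∏ j : Fin m, toFormalPeriod (of (B ((((j:ℕ):ℚ) + 1) * (s + 1)) (s + 1)))) * hC
    + (toFormalPeriod (of (IntegralRep.unit.constMul _ (isAlgebraic_ratCast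
          (∏ k : Fin (m + 1), (x + (k : ℚ) / ((m : ℚ) + 1) + s))))) *
        toFormalPeriod (of (IntegralRep.unit.constMul _ (isAlgebraic_ratCast
          (∏ j : Fin m, ∏ i ∈ range ((j:ℕ) + 1 + 1), ((((j:ℕ):ℚ) + 1 + 1) * s + i))))) *
        toFormalPeriod (of (IntegralRep.unit.constMul _
          (isAlgebraic_ratCast (((m : ℚ) + 1) ^ (m + 1))))) *
        toFormalPeriod (of (IntegralRep.unit.constMul (((m:ℝ) + 1) ^ (((m:ℝ) + 1) * (s:ℝ)))
          (MultGlue.isAlgebraic_gaussConst m s))) *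
        ∏ j : Fin m, toFormalPeriod (of (B ((((j:ℕ):ℚ) + 1) * (s + 1)) (s + 1)))) * hBB
    + (toFormalPeriod (of (IntegralRep.unit.constMul _ (isAlgebraic_ratCast
          (∏ k : Fin (m + 1), (x + (k : ℚ) / ((m : ℚ) + 1) + s))))) *
        toFormalPeriod (of (IntegralRep.unit.constMul _
          (isAlgebraic_ratCast (((m : ℚ) + 1) ^ (m + 1))))) *
        toFormalPeriod (of (IntegralRep.unit.constMul (((m:ℝ) + 1) ^ (((m:ℝ) + 1) * (s:ℝ)))
          (MultGlue.isAlgebraic_gaussConst m s))) *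
        toFormalPeriod (of (IntegralRep.unit.constMul _ (isAlgebraic_ratCast
          (∏ i ∈ range (m + 1), (((m : ℚ) + 1) * s + i))))) *
        toFormalPeriod (of (B (((m:ℚ) + 1) * x) (((m:ℚ) + 1) * s)))) * hCC
    - (toFormalPeriod (of (IntegralRep.unit.constMul (((m:ℝ) + 1) ^ (((m:ℝ) + 1) * (s:ℝ)))
          (MultGlue.isAlgebraic_gaussConst m s))) *
        toFormalPeriod (of (B (((m:ℚ) + 1) * x) (((m:ℚ) + 1) * s))) *
        ∏ j : Fin m, toFormalPeriod (of (B ((((j:ℕ):ℚ) + 1) * s) s))) * hQ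

end TranslateSGen

/-- **Registered sub-goal `gm_of_gm_succ_s`** (the `s`-translation of the shifted family in general
dimension): for every `m` and rational `x, s > 0`, the shifted Gauss multiplication `GM(m; x, s+1)`
inside the Kontsevich–Zagier rules (pinned form: every box representation of
`∏_(k≤m) B(x + k/(m+1), ·)` is equivalent to every box representation of
`(m+1)^((m+1)·) B((m+1)x, (m+1)·) ∏_(j=1)^m B(j·, ·)`) implies `GM(m; x, s)` — in the formal period
ring the two differ by `(m+1) + (m+1) + ∑_(j<m) (j+2)` translations `B(u, v+1) = B(u,v)·v/(u+v)`
(one Newton–Leibniz move each, `KZ.betaTranslation_equivalent`), the constant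
`(m+1)^((m+1)(s+1)) = (m+1)^(m+1) · (m+1)^((m+1)s)`, and a nonzero rational point constant, which
is a unit (`TranslateSGen.gm_prod_eq_step`); the pinned forms are converted by
`TranslateX.prod_eq_of_pinned` / `TranslateS.pinned_of_prod_eq`.
[cite: AndrewsAskeyRoy1999, Thm 1.5.2] -/
theorem gm_of_gm_succ_s : ∀ (m : ℕ) (x s : ℚ), 0 < x → 0 < s → (∀ (r r' : KZ.IntegralRep (m + 1)), r.domain = {z | ∀ i, z i ∈ Set.Ioo (0:ℝ) 1} → Set.EqOn r.integrand (fun z => ∏ k : Fin (m + 1), (z k) ^ (((x:ℝ)) + ((k:ℕ):ℝ) / ((m:ℝ) + 1) - 1) * (1 - z k) ^ (((((s + 1 : ℚ)):ℝ)) - 1)) r.domain → r'.domain = {z | ∀ i, z i ∈ Set.Ioo (0:ℝ) 1} → Set.EqOn r'.integrand (fun z => ((m:ℝ) + 1) ^ (((m:ℝ) + 1) * ((((s + 1 : ℚ)):ℝ))) * ((z 0) ^ (((m:ℝ) + 1) * ((x:ℝ)) - 1) * (1 - z 0) ^ (((m:ℝ) + 1) * ((((s + 1 : ℚ)):ℝ))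 - 1)) * ∏ j : Fin m, (z j.succ) ^ ((((j:ℕ):ℝ) + 1) * ((((s + 1 : ℚ)):ℝ)) - 1) * (1 - z j.succ) ^ (((((s + 1 : ℚ)):ℝ)) - 1)) r'.domain → KZ.Equivalent r r') →
    ∀ (r r' : KZ.IntegralRep (m + 1)), r.domain = {z | ∀ i, z i ∈ Set.Ioo (0:ℝ) 1} → Set.EqOn r.integrand (fun z => ∏ k : Fin (m + 1), (z k) ^ (((x:ℝ)) + ((k:ℕ):ℝ) / ((m:ℝ) + 1) - 1) * (1 - z k) ^ (((s:ℝ)) - 1)) r.domain → r'.domain = {z | ∀ i, z i ∈ Set.Ioo (0:ℝ) 1} → Set.EqOn r'.integrand (fun z => ((m:ℝ) + 1) ^ (((m:ℝ) + 1) * ((s:ℝ))) * ((z 0) ^ (((m:ℝ) + 1) * ((x:ℝ)) - 1) * (1 - z 0) ^ (((m:ℝ) + 1) * ((s:ℝ)) - 1)) * ∏ j : Fin m, (z j.succ) ^ ((((j:ℕ):ℝ) + 1) * ((s:ℝ)) - 1) * (1 - z j.succ) ^ (((s:ℝ)) - 1)) r'.domain → KZ.Equivalent r r' := by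
  intro m x s hx hs hGM
  obtain ⟨B, hB⟩ := MultGlue.exists_betaFamily
  have hs1 : (0:ℚ) < s + 1 := by positivity
  exact TranslateS.pinned_of_prod_eq hB m hx hs
    (TranslateSGen.gm_prod_eq_step hB m hx hs (TranslateX.prod_eq_of_pinned hB m hx hs1 hGM))

end Summit.KontsevichZagierPeriods.TerasomaMultiplication.MultiplicationAccessible

end
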